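import Summits.QuantumFields.YangMills.Theorems.SmallFieldWideningLargeFieldMassRefinementTailPlainStab

/-!
# Route `SmallFieldWidening`, crux r3 `LargeFieldMassRefinementTail` (stmt-QuantumFields-22884), line `birth` v6 — `PlainStab` ALSO GIVES THE PER-PLAQUETTE SCHEMA AT
# EVERY HEIGHT (uniform constants) AND HENCE CRUX K2 `UnitScaleTilt.HistoryTail` (stmt-QuantumFields-18916)
# (support file; width seat `ym-line-sfw-p2-w2` gen 17; `PlainStab`, the stub, the four cruxes and rung R3 stay OPEN)

WHAT THIS IS NOT.  No estimate of Bałaban's programme is proved; nothing bears on the Yang–Mills mass gap; rung R3 (`YM3TorusSU2`) is a RECORD rung.  The companion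
file `…PlainStab` reduced the shared stub (hence cruxes 22884, 26243, 19936) to `PlainStab` — the one-sided one-step UV-stability of the unconditioned unit-plaquette tail.
This file records that the same hypothesis yields the stronger UNCONDITIONED per-plaquette schema at every height (the K2 tree's `stub_perPlaquetteOfAlpha` shape) and
therefore the parent route's crux K2:

* §1 `plainUnitTail_of_plainStab` — `PlainStab` ⇒ the unconditioned unit-plaquette tail `Gibbs_K{θ_{b₀}(0) ≤ |Ū^K(∂p) − 1|} ≤ C·γ^{-N}·e^{−c p(√γ)²}` for EVERY run `K ≥ 1`,
  constants uniform in the family (chain down to `K = 1` + `FirstExitDeepBoundedHeight.perPlaquette_boundedHeight_uniform 1`);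
* §2 `gibbsK_real_plaq_eq_refine` — the plain level shift: height `j` of run `j + d` of `F` is the unit top of run `j` of `F.refine d` (no history clause);
  ★ `perPlaquette_allHeights_of_plainStab` — `PlainStab` ⇒ `Gibbs^F_K{θ_{b₀}(K−j) ≤ |Ū^j(∂p) − 1|} ≤ C·β_{K−j}^N·e^{−c p(g_{K−j})²}` for ALL `1 ≤ j ≤ K`, ALL families of block size `L`,
  `γ ≤ γ₁` — [Balaban1985UV3] (71) as a probability bound, uniform in the height;
* §3 ★ `historyTail_of_plainStab` — hence `Summit.QuantumFields.YangMills.Theses.UnitScaleTilt.HistoryTail` (stmt-QuantumFields-18916, every free top fraction `m > 0`) BY NAME,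
  through the tree's `T3AveragedTailProfile.historyTailAt_of_perPlaquette`.  So `PlainStab` carries kernel glue to FOUR open cruxes (18916, 19936, 22884, 26243).

References: T. Bałaban, Commun. Math. Phys. **102** (1985) 255–275 [Balaban1985UV3] ((1)–(3) p.256, (7) p.257, (71) p.273); CMP **109** (1987) 249–301 [Balaban1987RG1]
((0.11) p.253, Thm 1 p.259).
-/

noncomputable section

open MeasureTheory Filter Topology
open scoped BigOperators
open Literature.MathematicalPhysics.QuantumFieldTheory.Balaban1983to89
open Literature.MathematicalPhysics.QuantumFieldTheory.Balaban1983to89.Missing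
open Literature.MathematicalPhysics.QuantumFieldTheory.Balaban1983to89.T3ContinuumYM3Torus
open Literature.MathematicalPhysics.QuantumFieldTheory.Balaban1983to89.T3UnitScaleTilt
open Literature.MathematicalPhysics.QuantumFieldTheory.Balaban1983to89.T3UnitLawDensityEML (ℰp measurableE_ℰp)
open Literature.MathematicalPhysics.QuantumFieldTheory.Balaban1983to89.T3LevelShift
open Literature.MathematicalPhysics.QuantumFieldTheory.Balaban1983to89.T3ThresholdRemoval
open Literature.MathematicalPhysics.QuantumFieldTheory.Balaban1983to89.T3AveragedTailProfile (historyTailAt_of_perPlaquette)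
open Summit.QuantumFields.YangMills.Theorems.LargeFieldMassRefinementTailOfHeightTail (θBal_mul_pow)
open Summit.QuantumFields.YangMills.Theorems.LargeFieldMassRefinementTailUnitTop (gibbsMeasure_real_preimage_fieldShift)
open Summit.QuantumFields.YangMills.Theorems.FirstExitDeepBoundedHeight (perPlaquette_boundedHeight_uniform)
open Summit.QuantumFields.YangMills.Theorems.LargeFieldMassRefinementTailPlainStab (chain_le_one)

namespace Summit.QuantumFields.YangMills.Theorems.LargeFieldMassRefinementTailPlainStabK2

/-! ## §1 The unconditioned unit-plaquette tail of every run from `PlainStab` -/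

/-- **`PlainStab` ⇒ THE UNCONDITIONED UNIT-PLAQUETTE TAIL OF EVERY RUN `K ≥ 1`**, constants uniform in the family: chain the one-step slacks down to the one-step run,
whose unit tail is the volume-uniform bounded-height tail (`perPlaquette_boundedHeight_uniform 1`). [cite: Balaban1985UV3, (7) p.257 and (71) p.273] -/
theorem plainUnitTail_of_plainStab
    (hPS : ∀ (L : ℕ) (b₀ p₀ : ℝ), 0 < b₀ → 2 < p₀ → ∃ γ₁ : ℝ, 0 < γ₁ ∧ γ₁ ≤ 1 ∧
      ∀ η : ℝ, 0 < η → ∃ A : ℝ, ∀ (F : T3Family) (γ : ℝ), F.L = L → 0 < γ → γ ≤ γ₁ →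
        ∀ q : Plaq (F.P 0) 0, ∃ ρ : ℕ → ℝ,
          (∀ K : ℕ, ∑ k ∈ Finset.Ico 1 K, ρ k ≤ A + η * B10.pFun b₀ p₀ (Real.sqrt γ) ^ 2) ∧
          ∀ K : ℕ, 1 ≤ K →
            (gibbsK F ℰp γ (K + 1)).real {U | θBal F.L γ b₀ p₀ 0 ≤ GaugeGroup.dist1 (GaugeField.plaqHol
                (Averaging.iter (fun i => BlockAveraging.blockAvg (P := F.P (K + 1)) (j := i) ℰp) (K + 1) U)
                (plaqShift (F.sitesPerDir_unit (K + 1)) q))} ≤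
            Real.exp (ρ K) *
            (gibbsK F ℰp γ K).real {U | θBal F.L γ b₀ p₀ 0 ≤ GaugeGroup.dist1 (GaugeField.plaqHol
                (Averaging.iter (fun i => BlockAveraging.blockAvg (P := F.P K) (j := i) ℰp) K U)
                (plaqShift (F.sitesPerDir_unit K) q))}) :
    ∀ (L : ℕ) (b₀ p₀ : ℝ), 0 < b₀ → 2 < p₀ → ∃ (γ₁ C c : ℝ) (N : ℕ), 0 < γ₁ ∧ γ₁ ≤ 1 ∧ 0 < c ∧ 0 ≤ C ∧
      ∀ (F : T3Family) (γ : ℝ), F.L = L → 0 < γ → γ ≤ γ₁ → ∀ (K : ℕ), 1 ≤ K → ∀ p : Plaq (F.P K) K,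
        (gibbsK F ℰp γ K).real {U | θBal F.L γ b₀ p₀ 0 ≤ GaugeGroup.dist1 (GaugeField.plaqHol
            (Averaging.iter (fun i => BlockAveraging.blockAvg (P := F.P K) (j := i) ℰp) K U) p)} ≤
        C * (γ⁻¹) ^ N * Real.exp (-(c * B10.pFun b₀ p₀ (Real.sqrt γ) ^ 2)) := by
  intro L b₀ p₀ hb₀ hp₀
  obtain ⟨γb, C_b, c_b, N_b, hγb, hγb1, hc_b, hC_b, hbase⟩ := perPlaquette_boundedHeight_uniform 1 L b₀ p₀ hb₀ (by linarith)
  obtain ⟨γs, hγs, hγs1, hslack⟩ := hPS L b₀ p₀ hb₀ hp₀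
  obtain ⟨A, hA⟩ := hslack (c_b / 2) (half_pos hc_b)
  refine ⟨min γb γs, C_b * Real.exp A, c_b / 2, N_b, lt_min hγb hγs, (min_le_left _ _).trans hγb1, half_pos hc_b, by positivity,
    fun F γ hFL hγ hle K hK p => ?_⟩
  haveI := isProbabilityMeasure_gibbsK F ℰp hγ.le K
  set q : Plaq (F.P 0) 0 := (plaqShift (F.sitesPerDir_unit K)).symm p with hq
  obtain ⟨ρ, hρ, hstep⟩ := hA F γ hFL hγ (hle.trans (min_le_right _ _)) q
  have hch := chain_le_one (ρ := ρ)
    (c := fun K' => (gibbsK F ℰp γ K').real {U | θBal F.L γ b₀ p₀ 0 ≤ GaugeGroup.dist1 (GaugeField.plaqHol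
      (Averaging.iter (fun i => BlockAveraging.blockAvg (P := F.P K') (j := i) ℰp) K' U) (plaqShift (F.sitesPerDir_unit K') q))})
    hstep K hK
  beta_reduce at hch
  have hpq : plaqShift (F.sitesPerDir_unit K) q = p := (plaqShift (F.sitesPerDir_unit K)).apply_symm_apply p
  rw [hpq] at hch
  have hb := hbase F γ hFL hγ (hle.trans (min_le_left _ _)) 1 1 le_rfl le_rfl (plaqShift (F.sitesPerDir_unit 1) q)
  simp only [Nat.sub_self, pow_zero, mul_one] at hb
  have hexp : Real.exp (∑ k ∈ Finset.Ico 1 K, ρ k) ≤ Real.exp (A + c_b / 2 * B10.pFun b₀ p₀ (Real.sqrt γ) ^ 2) :=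
    Real.exp_le_exp.mpr (hρ K)
  refine hch.trans ((mul_le_mul hexp hb measureReal_nonneg (Real.exp_nonneg _)).trans (le_of_eq ?_))
  have hsplit : Real.exp (A + c_b / 2 * B10.pFun b₀ p₀ (Real.sqrt γ) ^ 2) * Real.exp (-(c_b * B10.pFun b₀ p₀ (Real.sqrt γ) ^ 2)) =
      Real.exp A * Real.exp (-(c_b / 2 * B10.pFun b₀ p₀ (Real.sqrt γ) ^ 2)) := by
    rw [← Real.exp_add, ← Real.exp_add]; ring_nf
  calc Real.exp (A + c_b / 2 * B10.pFun b₀ p₀ (Real.sqrt γ) ^ 2) * (C_b * (γ⁻¹) ^ N_b * Real.exp (-(c_b * B10.pFun b₀ p₀ (Real.sqrt γ) ^ 2)))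
      = C_b * (γ⁻¹) ^ N_b * (Real.exp (A + c_b / 2 * B10.pFun b₀ p₀ (Real.sqrt γ) ^ 2) *
          Real.exp (-(c_b * B10.pFun b₀ p₀ (Real.sqrt γ) ^ 2))) := by ring
    _ = C_b * Real.exp A * (γ⁻¹) ^ N_b * Real.exp (-(c_b / 2 * B10.pFun b₀ p₀ (Real.sqrt γ) ^ 2)) := by rw [hsplit]; ring

/-! ## §2 The per-plaquette schema at every height from `PlainStab` -/

/-- **THE PLAIN LEVEL SHIFT**: the Gibbs mass (run `j + d` of `F` at `γ`) of «`θ_γ(d) ≤ |Ū^j(∂p) − 1|`» equals the Gibbs mass (run `j` of `F.refine d` at `γL^{-d}`) of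
«`θ_{γL^{-d}}(0) ≤ |Ū^j(∂(plaqShift p)) − 1|`» — the companion `gibbsK_real_firstExit_eq_refine` without the history clause. [cite: Balaban1985UV3, (1)-(3) p.256; Balaban1987RG1, (0.11) p.253] -/
theorem gibbsK_real_plaq_eq_refine (F : T3Family) (γ : ℝ) (hγ : 0 ≤ γ) (b₀ p₀ : ℝ) (d j : ℕ) (p : Plaq (F.P (j + d)) j) :
    (gibbsK F ℰp γ (j + d)).real {U | θBal F.L γ b₀ p₀ d ≤ GaugeGroup.dist1 (GaugeField.plaqHol
        (Averaging.iter (fun i => BlockAveraging.blockAvg (P := F.P (j + d)) (j := i) ℰp) j U) p)} =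
      (gibbsK (F.refine d) ℰp (γ * ((F.L : ℝ)⁻¹) ^ d) j).real
        {V | θBal F.L (γ * ((F.L : ℝ)⁻¹) ^ d) b₀ p₀ 0 ≤ GaugeGroup.dist1 (GaugeField.plaqHol
            (Averaging.iter (fun i => BlockAveraging.blockAvg (P := (F.refine d).P j) (j := i) ℰp) j V)
            (plaqShift (F.sitesPerDir_eq (m := F.m) (K := j + d) (j := j) (m' := F.m + d) (K' := j) (j' := j) (by omega)) p))} := by
  have hmK : F.m + (j + d) = F.m + d + j := by omega
  have hβ : ((F.refine d).scheme ℰp (γ * ((F.L : ℝ)⁻¹) ^ d)).β j = (F.scheme ℰp γ).β (j + d) := F.refine_β ℰp γ d j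
  have hβ0 : 0 ≤ (F.scheme ℰp γ).β (j + d) := F.scheme_β_nonneg ℰp hγ (j + d)
  rw [gibbsK_eq, gibbsK_eq, hβ]
  refine (gibbsMeasure_real_preimage_fieldShift (G := Matrix.specialUnitaryGroup (Fin 2) ℂ)
    (sitesPerDir_refine_zero F d j) hβ0 _).symm.trans ?_
  congr 1
  ext V
  have key := iter_fieldShift ℰp hmK j V
  constructor
  · intro h
    change θBal F.L γ b₀ p₀ d ≤ _ at h
    erw [key, plaqHol_fieldShift] at h
    change θBal F.L (γ * ((F.L : ℝ)⁻¹) ^ d) b₀ p₀ 0 ≤ _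
    rw [θBal_mul_pow, zero_add]
    exact h
  · intro h
    change θBal F.L (γ * ((F.L : ℝ)⁻¹) ^ d) b₀ p₀ 0 ≤ _ at h
    rw [θBal_mul_pow, zero_add] at h
    change θBal F.L γ b₀ p₀ d ≤ _
    erw [key, plaqHol_fieldShift]
    exact h

/-- ★ **`PlainStab` ⇒ THE PER-PLAQUETTE SCHEMA AT EVERY HEIGHT, UNIFORMLY**: for every `L`, `0 < b₀`, `2 < p₀` there are `γ₁, C, c, N` with
`Gibbs^F_K{ θ_{b₀}(K−j) ≤ |Ū^j(∂p) − 1| } ≤ C·β_{K−j}^N·exp(−c·p_{b₀}(g_{K−j})²)` for every family `F` (`F.L = L`), `0 < γ ≤ γ₁`, every run `K`, every height `1 ≤ j ≤ K` and every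
level-`j` plaquette — §1 applied to `F.refine (K − j)` at `γL^{-(K−j)}` and transported by §2.  [Balaban1985UV3] (71) as a probability bound, uniform in the height, CONDITIONAL on
`PlainStab`. [cite: Balaban1985UV3, (7) p.257 and (71) p.273] -/
theorem perPlaquette_allHeights_of_plainStab
    (hPS : ∀ (L : ℕ) (b₀ p₀ : ℝ), 0 < b₀ → 2 < p₀ → ∃ γ₁ : ℝ, 0 < γ₁ ∧ γ₁ ≤ 1 ∧
      ∀ η : ℝ, 0 < η → ∃ A : ℝ, ∀ (F : T3Family) (γ : ℝ), F.L = L → 0 < γ → γ ≤ γ₁ →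
        ∀ q : Plaq (F.P 0) 0, ∃ ρ : ℕ → ℝ,
          (∀ K : ℕ, ∑ k ∈ Finset.Ico 1 K, ρ k ≤ A + η * B10.pFun b₀ p₀ (Real.sqrt γ) ^ 2) ∧
          ∀ K : ℕ, 1 ≤ K →
            (gibbsK F ℰp γ (K + 1)).real {U | θBal F.L γ b₀ p₀ 0 ≤ GaugeGroup.dist1 (GaugeField.plaqHol
                (Averaging.iter (fun i => BlockAveraging.blockAvg (P := F.P (K + 1)) (j := i) ℰp) (K + 1) U)
                (plaqShift (F.sitesPerDir_unit (K + 1)) q))} ≤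
            Real.exp (ρ K) *
            (gibbsK F ℰp γ K).real {U | θBal F.L γ b₀ p₀ 0 ≤ GaugeGroup.dist1 (GaugeField.plaqHol
                (Averaging.iter (fun i => BlockAveraging.blockAvg (P := F.P K) (j := i) ℰp) K U)
                (plaqShift (F.sitesPerDir_unit K) q))}) :
    ∀ (L : ℕ) (b₀ p₀ : ℝ), 0 < b₀ → 2 < p₀ → ∃ (γ₁ C c : ℝ) (N : ℕ), 0 < γ₁ ∧ γ₁ ≤ 1 ∧ 0 < c ∧ 0 ≤ C ∧
      ∀ (F : T3Family) (γ : ℝ), F.L = L → 0 < γ → γ ≤ γ₁ → ∀ (K j : ℕ), 1 ≤ j → j ≤ K → ∀ p : Plaq (F.P K) j,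
        (gibbsK F ℰp γ K).real {U | θBal F.L γ b₀ p₀ (K - j) ≤ GaugeGroup.dist1 (GaugeField.plaqHol
            (Averaging.iter (fun i => BlockAveraging.blockAvg (P := F.P K) (j := i) ℰp) j U) p)} ≤
        C * ((γ * ((F.L : ℝ)⁻¹) ^ (K - j))⁻¹) ^ N * Real.exp (-(c * B10.pFun b₀ p₀ (Real.sqrt (γ * ((F.L : ℝ)⁻¹) ^ (K - j))) ^ 2)) := by
  intro L b₀ p₀ hb₀ hp₀
  obtain ⟨γ₁, C, c, N, hγ₁, hγ₁1, hc, hC, h⟩ := plainUnitTail_of_plainStab hPS L b₀ p₀ hb₀ hp₀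
  refine ⟨γ₁, C, c, N, hγ₁, hγ₁1, hc, hC, fun F γ hFL hγ hle K j hj hjK p => ?_⟩
  obtain ⟨d, rfl⟩ := Nat.exists_eq_add_of_le hjK
  have hL1 : (1 : ℝ) ≤ F.L := by exact_mod_cast F.hL.2.le
  have hq0 : (0 : ℝ) < ((F.L : ℝ)⁻¹) ^ d := pow_pos (inv_pos.mpr (by linarith)) d
  have hq1 : ((F.L : ℝ)⁻¹) ^ d ≤ 1 := pow_le_one₀ (inv_nonneg.mpr (by linarith)) (inv_le_one_of_one_le₀ hL1)
  have hγ' : 0 < γ * ((F.L : ℝ)⁻¹) ^ d := mul_pos hγ hq0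
  have hγ'le : γ * ((F.L : ℝ)⁻¹) ^ d ≤ γ₁ := (mul_le_of_le_one_right hγ.le hq1).trans hle
  have happ := h (F.refine d) (γ * ((F.L : ℝ)⁻¹) ^ d) hFL hγ' hγ'le j hj
    (plaqShift (F.sitesPerDir_eq (m := F.m) (K := j + d) (j := j) (m' := F.m + d) (K' := j) (j' := j) (by omega)) p)
  rw [show j + d - j = d from Nat.add_sub_cancel_left j d, gibbsK_real_plaq_eq_refine F γ hγ.le b₀ p₀ d j p]
  exact happ

/-! ## §3 Crux K2 `UnitScaleTilt.HistoryTail` (stmt-QuantumFields-18916) from `PlainStab` -/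

/-- ★ **CRUX K2 `HistoryTail` (stmt-QuantumFields-18916; every free top fraction `m > 0`) FROM `PlainStab`**: the per-plaquette schema of §2 at the profile `(1, 3)` fed to
the tree's `historyTailAt_of_perPlaquette`.  Conditional certificate; `PlainStab` is NOT proved; nothing about the mass gap. [cite: Balaban1985UV3, (7) p.257 and (71) p.273] -/
theorem historyTail_of_plainStab
    (hPS : ∀ (L : ℕ) (b₀ p₀ : ℝ), 0 < b₀ → 2 < p₀ → ∃ γ₁ : ℝ, 0 < γ₁ ∧ γ₁ ≤ 1 ∧
      ∀ η : ℝ, 0 < η → ∃ A : ℝ, ∀ (F : T3Family) (γ : ℝ), F.L = L → 0 < γ → γ ≤ γ₁ →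
        ∀ q : Plaq (F.P 0) 0, ∃ ρ : ℕ → ℝ,
          (∀ K : ℕ, ∑ k ∈ Finset.Ico 1 K, ρ k ≤ A + η * B10.pFun b₀ p₀ (Real.sqrt γ) ^ 2) ∧
          ∀ K : ℕ, 1 ≤ K →
            (gibbsK F ℰp γ (K + 1)).real {U | θBal F.L γ b₀ p₀ 0 ≤ GaugeGroup.dist1 (GaugeField.plaqHol
                (Averaging.iter (fun i => BlockAveraging.blockAvg (P := F.P (K + 1)) (j := i) ℰp) (K + 1) U)
                (plaqShift (F.sitesPerDir_unit (K + 1)) q))} ≤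
            Real.exp (ρ K) *
            (gibbsK F ℰp γ K).real {U | θBal F.L γ b₀ p₀ 0 ≤ GaugeGroup.dist1 (GaugeField.plaqHol
                (Averaging.iter (fun i => BlockAveraging.blockAvg (P := F.P K) (j := i) ℰp) K U)
                (plaqShift (F.sitesPerDir_unit K) q))}) :
    Summit.QuantumFields.YangMills.Theses.UnitScaleTilt.HistoryTail := by
  intro L m hm
  obtain ⟨γ₁, C, c, N, hγ₁, hγ₁1, hc, hC, h⟩ := perPlaquette_allHeights_of_plainStab hPS L 1 3 one_pos (by norm_num)
  refine ⟨1, 3, γ₁, one_pos, by norm_num, hγ₁, fun F γ hFL hγ hle => ?_⟩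
  have hγ1 : γ ≤ 1 := hle.trans hγ₁1
  exact historyTailAt_of_perPlaquette F hγ hγ1 one_pos (by norm_num) hm
    ⟨C, N, c, hC, hc, fun K j hj hjK p => h F γ hFL hγ hle K j hj hjK p⟩

end Summit.QuantumFields.YangMills.Theorems.LargeFieldMassRefinementTailPlainStabK2

end
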